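import Summits.Ventures.Crystal3D.Kissing125.Estimates2
import Literature.Geometry.DiscreteGeometry.KissingFacetPenaltyRefined
import HarnessLib

/-!
# The main estimate (Hales Thm 2, `d₃`) and the census `≥ 23 contacts` — K25 copy at `κ = 7/32` (`h = 5/4`), part 3/4

HONEST FRAMING (cell pub-crystal3d, K-path at `h = 5/4`): this is NOT a result printed by Hales.  It is his
METHOD (arXiv:1209.6043, Theorem 3: the main estimate + the classification of the contact graphs of kissing
configurations, in the tree's form of a verified interval-arithmetic growth search, `Literature/…/KissingSearch*.lean`)
RE-RUN at the separation `5/2` instead of `2h₀ = 2.52` (largest long-side cosine `κ = 1 − (5/4)²/2 = 7/32` instead of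
`κ₀ = 1031/5000`).  The declarations are namespace-shadowing COPIES of the tree's declarations (same names, inside
`namespace Summit.Ventures.Crystal3D.Kissing125[.KissingSearch]`, original docstrings and citation tags kept — the tags
name the printed METHOD step each declaration implements); the diff to the originals is stated per file.  Generated by
`HOME/lean/kissing125/gen/mkfiles.py`; audit recipe in `HOME/lean/kissing125/README.md`.  Nothing here is asserted
about GAP(1.26) or any census.

THIS FILE: the κ-DEPENDENT declarations of `KissingMainEstimate` / `KissingFacetPenalty` / `KissingFacetPenaltyRefined` / `KissingTriangleDeficit` / `KissingContactCount` with `1031/5000 ↦ 7/32`, the `d₃` constants `0.103/0.27/0.36/0.5/0.63 ↦ 0.1/0.26/0.34/0.475/0.61` (corner principle on the new boxes; rational waypoints `575/2808`, `0.312`, `0.373`, `0.484`, `0.607`; `0.49` unchanged), the unit price `0.103 ↦ 0.1`, and the budget `1.62 ↦ 1.56` via the new `lt_hales_sol0_5504` (`sol₀ > 0.5504`, two half-angle steps) / `budget_lt_156`; `fanPenaltyLB_eq` re-proved for the shadowing `fanPenaltyLB`. κ-independent lemmas (`contactCount`, `triangleUnits`, deficits/supplies, `EdgeDeficit`, `FanCensus`,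 `ContactCount` A–B, …) are the tree's, unchanged. Headline: `twentythree_le_card_contactPairsAt` at `7/32`.  (Part 3 of 4: lines 505–832 of the transformed copy; the split is only for the 400-line rule.)
  v3.1 (gate `dedup.landed`): the generic lemma `sol0_add_le_sphExcess_of_one_contact_of_nonpos_of_nonpos` of `Literature/Geometry/DiscreteGeometry/KissingFacetPenaltyRefined.lean` is NOT re-declared (a verbatim copy would restate the tree's declaration); uses of `sol0_add_le_sphExcess_of_one_contact_of_nonpos_of_nonpos` call the tree's `Literature.Geometry.DiscreteGeometry.sol0_add_le_sphExcess_of_one_contact_of_nonpos_of_nonpos` by full name (hence `import …KissingFacetPenaltyRefined`).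

## References
* T. C. Hales, *A proof of Fejes Tóth's conjecture on sphere packings with kissing number twelve*,
  arXiv:1209.6043 (2012): Definition 1, Theorem 2 (main estimate `d₃`), Theorem 3, Lemmas 7–10. [`Hales2012`]
* R. E. Moore, *Interval Analysis* (1966), Theorem 3.1, §4.4. [`Moore1966`]
-/

noncomputable section

namespace Summit.Ventures.Crystal3D.Kissing125
open Literature.Geometry.DiscreteGeometry
open Real RealInnerProductSpace InnerProductGeometry Finset

section FanEq
variable {X : Finset (EuclideanSpace ℝ (Fin 3))}

/-- The constant of the main estimate of a fan triangle is `trianglePenaltyLB` of its side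
cosines (in the `fVert` spelling); K25 copy for the shadowing `fanPenaltyLB`. [folklore] -/
theorem fanPenaltyLB_eq {c : (EuclideanSpace ℝ (Fin 3))} (hc : c ≠ 0) (i : ℕ) :
    fanPenaltyLB X c i = trianglePenaltyLB ⟪fVert X c (i + 1), fVert X c (i + 2)⟫
      ⟪fVert X c 0, fVert X c (i + 2)⟫ ⟪fVert X c 0, fVert X c (i + 1)⟫ := by
  unfold fanPenaltyLB; rw [dif_pos hc, fVert_eq hc, fVert_eq hc, fVert_eq hc]

end FanEq


/-! ### Part A. The case `(1,0,2)`: one contact, two very long sides -/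

section Estimate


variable {a b c : (EuclideanSpace ℝ (Fin 3))}

/-- **The refined constant of the main estimate**: `trianglePenaltyLB`, except `0.49` (instead
of `0.36`) for exactly one contact side and two very long sides.
[cite: Hales2012, Theorem 2 (the function d₃)] -/
def trianglePenaltyLB₂ (x y z : ℝ) : ℝ :=
  if contactCount x y z = 1 ∧ ((x < 0 ∧ y < 0) ∨ (x < 0 ∧ z < 0) ∨ (y < 0 ∧ z < 0)) then 0.49
  else trianglePenaltyLB x y z

/-- `trianglePenaltyLB₂` is nonnegative. [folklore] -/
theorem trianglePenaltyLB₂_nonneg (x y z : ℝ) : 0 ≤ trianglePenaltyLB₂ x y z := by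
  unfold trianglePenaltyLB₂
  split_ifs
  · norm_num
  · exact trianglePenaltyLB_nonneg x y z

/-- `trianglePenaltyLB ≤ trianglePenaltyLB₂`. [folklore] -/
theorem trianglePenaltyLB_le_trianglePenaltyLB₂ (x y z : ℝ) :
    trianglePenaltyLB x y z ≤ trianglePenaltyLB₂ x y z := by
  unfold trianglePenaltyLB₂
  split_ifs with h
  · rw [trianglePenaltyLB, if_neg (by rw [h.1]; norm_num), if_neg (by rw [h.1]; norm_num),
      if_pos h.1]
    split_ifs <;> norm_num
  · exact le_rfl

/-- **The refined main estimate for a triangle given by its side types**: under the hypotheses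
of `le_sphExcess_sub_sol0_of_sides`, `trianglePenaltyLB₂ x y z ≤ sphExcess a b c − sol₀`.
[cite: Hales2012, Theorem 2 (A ≥ sol₀ + d₃(r,s,t))] -/
theorem le_sphExcess_sub_sol0_of_sides₂ (ha : ‖a‖ = 1) (hb : ‖b‖ = 1)
    (hc : ‖c‖ = 1) (hli : LinearIndependent ℝ ![a, b, c])
    (hx : ⟪b, c⟫ = 1 / 2 ∨ (-1 / 2 ≤ ⟪b, c⟫ ∧ ⟪b, c⟫ ≤ 7 / 32))
    (hy : ⟪a, c⟫ = 1 / 2 ∨ (-1 / 2 ≤ ⟪a, c⟫ ∧ ⟪a, c⟫ ≤ 7 / 32))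
    (hz : ⟪a, b⟫ = 1 / 2 ∨ (-1 / 2 ≤ ⟪a, b⟫ ∧ ⟪a, b⟫ ≤ 7 / 32))
    (hsum : -3 / 4 < ⟪b, c⟫ + ⟪a, c⟫ + ⟪a, b⟫)
    (hix : ⟪a, c⟫ = 1 / 2 → ⟪a, b⟫ = 1 / 2 → -1 / 3 ≤ ⟪b, c⟫)
    (hiy : ⟪b, c⟫ = 1 / 2 → ⟪a, b⟫ = 1 / 2 → -1 / 3 ≤ ⟪a, c⟫)
    (hiz : ⟪b, c⟫ = 1 / 2 → ⟪a, c⟫ = 1 / 2 → -1 / 3 ≤ ⟪a, b⟫) :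
    trianglePenaltyLB₂ ⟪b, c⟫ ⟪a, c⟫ ⟪a, b⟫ ≤ sphExcess a b c - hales_sol0 := by
  unfold trianglePenaltyLB₂
  split_ifs with h
  · obtain ⟨hcc, hneg⟩ := h
    have hba : ⟪b, a⟫ = ⟪a, b⟫ := real_inner_comm a b
    have hca : ⟪c, a⟫ = ⟪a, c⟫ := real_inner_comm a c
    have hcb : ⟪c, b⟫ = ⟪b, c⟫ := real_inner_comm b c
    rcases hneg with ⟨h1, h2⟩ | ⟨h1, h2⟩ | ⟨h1, h2⟩
    · -- `bc`, `ac` very long; the contact must be `ab`: triangle `(a, b, c)`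
      have hx' : ¬⟪b, c⟫ = 1 / 2 := fun h => by rw [h] at h1; norm_num at h1
      have hy' : ¬⟪a, c⟫ = 1 / 2 := fun h => by rw [h] at h2; norm_num at h2
      rcases hz with hz | hz
      · have hxr : -1 / 2 ≤ ⟪b, c⟫ := (hx.resolve_left hx').1
        have hyr : -1 / 2 ≤ ⟪a, c⟫ := (hy.resolve_left hy').1
        have := Literature.Geometry.DiscreteGeometry.sol0_add_le_sphExcess_of_one_contact_of_nonpos_of_nonpos ha hb hc hli hz
          ⟨hyr, h2.le⟩ ⟨hxr, h1.le⟩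
        norm_num at this ⊢; linarith
      · have hz' : ¬⟪a, b⟫ = 1 / 2 := fun h => by rw [h] at hz; norm_num at hz
        rw [contactCount, if_neg hx', if_neg hy', if_neg hz'] at hcc
        exact absurd hcc (by norm_num)
    · -- `bc`, `ab` very long; the contact must be `ac`: triangle `(a, c, b)`
      have hx' : ¬⟪b, c⟫ = 1 / 2 := fun h => by rw [h] at h1; norm_num at h1
      have hz' : ¬⟪a, b⟫ = 1 / 2 := fun h => by rw [h] at h2; norm_num at h2
      rcases hy with hy | hy
      · have hxr : -1 / 2 ≤ ⟪b, c⟫ := (hx.resolve_left hx').1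
        have hzr : -1 / 2 ≤ ⟪a, b⟫ := (hz.resolve_left hz').1
        have hli' : LinearIndependent ℝ ![a, c, b] :=
          linearIndependent_triple_perm hli 0 2 1 (by decide) (by decide) (by decide)
        have := Literature.Geometry.DiscreteGeometry.sol0_add_le_sphExcess_of_one_contact_of_nonpos_of_nonpos ha hc hb hli' hy
          ⟨hzr, h2.le⟩ (by rw [hcb]; exact ⟨hxr, h1.le⟩)
        rw [sphExcess_swap₂₃] at this
        norm_num at this ⊢; linarith
      · have hy' : ¬⟪a, c⟫ = 1 / 2 := fun h => by rw [h] at hy; norm_num at hy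
        rw [contactCount, if_neg hx', if_neg hy', if_neg hz'] at hcc
        exact absurd hcc (by norm_num)
    · -- `ac`, `ab` very long; the contact must be `bc`: triangle `(b, c, a)`
      have hy' : ¬⟪a, c⟫ = 1 / 2 := fun h => by rw [h] at h1; norm_num at h1
      have hz' : ¬⟪a, b⟫ = 1 / 2 := fun h => by rw [h] at h2; norm_num at h2
      rcases hx with hx | hx
      · have hyr : -1 / 2 ≤ ⟪a, c⟫ := (hy.resolve_left hy').1
        have hzr : -1 / 2 ≤ ⟪a, b⟫ := (hz.resolve_left hz').1
        have hli' : LinearIndependent ℝ ![b, c, a] :=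
          linearIndependent_triple_perm hli 1 2 0 (by decide) (by decide) (by decide)
        have := Literature.Geometry.DiscreteGeometry.sol0_add_le_sphExcess_of_one_contact_of_nonpos_of_nonpos hb hc ha hli' hx
          (by rw [hba]; exact ⟨hzr, h2.le⟩) (by rw [hca]; exact ⟨hyr, h1.le⟩)
        rw [sphExcess_rotate] at this
        norm_num at this ⊢; linarith
      · have hx' : ¬⟪b, c⟫ = 1 / 2 := fun h => by rw [h] at hx; norm_num at hx
        rw [contactCount, if_neg hx', if_neg hy', if_neg hz'] at hcc
        exact absurd hcc (by norm_num)
  · exact le_sphExcess_sub_sol0_of_sides ha hb hc hli hx hy hz hsum hix hiy hiz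

end Estimate

/-! ### Part B. The refined constant on the fan triangles and the refined budget inequality -/

section Facets


variable {X : Finset (EuclideanSpace ℝ (Fin 3))}

/-- **The refined constant of the `i`-th fan triangle `(w 0, w (i+1), w (i+2))` of the facet of
`c`** (`trianglePenaltyLB₂` of its side cosines). [cite: Hales2012, Theorem 2] -/
def fanPenaltyLB₂ (X : Finset (EuclideanSpace ℝ (Fin 3))) (c : (EuclideanSpace ℝ (Fin 3))) (i : ℕ) : ℝ :=
  trianglePenaltyLB₂ ⟪fVert X c (i + 1), fVert X c (i + 2)⟫ ⟪fVert X c 0, fVert X c (i + 2)⟫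
    ⟪fVert X c 0, fVert X c (i + 1)⟫

/-- `fanPenaltyLB₂` is nonnegative. [folklore] -/
theorem fanPenaltyLB₂_nonneg (X : Finset (EuclideanSpace ℝ (Fin 3))) (c : (EuclideanSpace ℝ (Fin 3))) (i : ℕ) : 0 ≤ fanPenaltyLB₂ X c i :=
  trianglePenaltyLB₂_nonneg _ _ _

/-- `fanPenaltyLB ≤ fanPenaltyLB₂`. [folklore] -/
theorem fanPenaltyLB_le_fanPenaltyLB₂ {c : (EuclideanSpace ℝ (Fin 3))} (hc : c ≠ 0) (i : ℕ) :
    fanPenaltyLB X c i ≤ fanPenaltyLB₂ X c i := by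
  rw [fanPenaltyLB_eq hc]; exact trianglePenaltyLB_le_trianglePenaltyLB₂ _ _ _

/-- **The refined main estimate on a fan triangle of a facet**: for twelve unit vectors whose
distinct pairs have inner product `1/2` or `≤ κ₀`, a facet normal `c` and `i + 2 < m_c`, the
penalty `sphExcess − sol₀` of the fan triangle `(w 0, w (i+1), w (i+2))` is at least
`fanPenaltyLB₂ X c i`. [cite: Hales2012, Theorem 2] -/
theorem fanPenaltyLB₂_le (h12 : X.card = 12) (hX1 : ∀ y ∈ X, ‖y‖ = 1)
    (hV : ∀ y ∈ X, ∀ y' ∈ X, y ≠ y' → ⟪y, y'⟫ = 1 / 2 ∨ ⟪y, y'⟫ ≤ 7 / 32)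
    {c : (EuclideanSpace ℝ (Fin 3))} (hc : c ∈ facetNormals X) {i : ℕ} (hi : i + 2 < (tightSet X c).card) :
    fanPenaltyLB₂ X c i ≤
      sphExcess (fVert X c 0) (fVert X c (i + 1)) (fVert X c (i + 2)) - hales_sol0 := by
  have hp : ∀ y ∈ X, ∀ y' ∈ X, y ≠ y' → ⟪y, y'⟫ ≤ 1 / 2 := fun y hy y' hy' h =>
    (hV y hy y' hy' h).elim le_of_eq fun h' => by linarith
  have hc0 := ne_zero_of_mem_facetNormals hX1 hc
  have hi' : i + 2 < (facetAngles X c hc0).card := by rwa [card_facetAngles hX1 hc0]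
  unfold fanPenaltyLB₂
  rw [fVert_eq hc0, fVert_eq hc0, fVert_eq hc0]
  set w := facetVertex X c hc0 with hw
  have h0 : w 0 ∈ tightSet X c := facetVertex_mem hc0 (by omega)
  have h1 : w (i + 1) ∈ tightSet X c := facetVertex_mem hc0 (by omega)
  have h2 : w (i + 2) ∈ tightSet X c := facetVertex_mem hc0 hi'
  have hu0 := hX1 _ (mem_tightSet.1 h0).1
  have hu1 := hX1 _ (mem_tightSet.1 h1).1
  have hu2 := hX1 _ (mem_tightSet.1 h2).1
  have hinj := facetVertex_injOn (X := X) hc0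
  have hne01 : w 0 ≠ w (i + 1) := fun h => by
    have := hinj (Finset.mem_coe.2 (Finset.mem_range.2 (by omega)))
      (Finset.mem_coe.2 (Finset.mem_range.2 (by omega))) h
    omega
  have hne02 : w 0 ≠ w (i + 2) := fun h => by
    have := hinj (Finset.mem_coe.2 (Finset.mem_range.2 (by omega)))
      (Finset.mem_coe.2 (Finset.mem_range.2 hi')) h
    omega
  have hne12 : w (i + 1) ≠ w (i + 2) := fun h => by
    have := hinj (Finset.mem_coe.2 (Finset.mem_range.2 (by omega)))
      (Finset.mem_coe.2 (Finset.mem_range.2 hi')) h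
    omega
  have hor := orient3_facetVertex_pos hX1 hc (i := 0) (j := i + 1) (k := i + 2) (by omega)
    (by omega) hi'
  have hli : LinearIndependent ℝ ![w 0, w (i + 1), w (i + 2)] :=
    linearIndependent_of_orient3_ne_zero hor.ne'
  refine le_sphExcess_sub_sol0_of_sides₂ hu0 hu1 hu2 hli
    (inner_cases_of_tight h12 hX1 hV hc h1 h2 hne12)
    (inner_cases_of_tight h12 hX1 hV hc h0 h2 hne02)
    (inner_cases_of_tight h12 hX1 hV hc h0 h1 hne01)
    (by linarith [sum_inner_gt_of_tight h12 hX1 hp hc h0 h1 h2])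
    (fun ha hb => (neg_third_lt_inner_of_isosceles_tight h12 hX1 hp hc h0 h1 h2 hb ha hne12).le)
    (fun ha hb => ?_) (fun ha hb => ?_)
  · have hb' : ⟪w (i + 1), w 0⟫ = 1 / 2 := by rw [real_inner_comm]; exact hb
    exact (neg_third_lt_inner_of_isosceles_tight h12 hX1 hp hc h1 h0 h2 hb' ha hne02).le
  · have ha' : ⟪w (i + 2), w (i + 1)⟫ = 1 / 2 := by rw [real_inner_comm]; exact ha
    have hb' : ⟪w (i + 2), w 0⟫ = 1 / 2 := by rw [real_inner_comm]; exact hb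
    exact (neg_third_lt_inner_of_isosceles_tight h12 hX1 hp hc h2 h0 h1 hb' ha' hne01).le

/-- **The refined main estimate on a facet**: `Σ_i fanPenaltyLB₂ ≤ 4π · frac(c) − (m_c − 2) sol₀`.
[cite: Hales2012, Theorem 2 and Lemma 4] -/
theorem sum_fanPenaltyLB₂_le_facet_weight (h12 : X.card = 12) (hX1 : ∀ y ∈ X, ‖y‖ = 1)
    (hV : ∀ y ∈ X, ∀ y' ∈ X, y ≠ y' → ⟪y, y'⟫ = 1 / 2 ∨ ⟪y, y'⟫ ≤ 7 / 32)
    (h0 : (0 : (EuclideanSpace ℝ (Fin 3))) ∈ interior (convexHull ℝ (X : Set (EuclideanSpace ℝ (Fin 3))))) {c : (EuclideanSpace ℝ (Fin 3))} (hc : c ∈ facetNormals X) :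
    ∑ i ∈ range ((tightSet X c).card - 2), fanPenaltyLB₂ X c i ≤
      4 * π * ballFraction (0 : (EuclideanSpace ℝ (Fin 3))) (argmaxCone (facetNormals X) c) -
        ((tightSet X c).card - 2) * hales_sol0 := by
  have hc0 := ne_zero_of_mem_facetNormals hX1 hc
  set m := (facetAngles X c hc0).card with hm
  have hmt : (tightSet X c).card = m := (card_facetAngles hX1 hc0).symm
  have hm3 : 3 ≤ m := by rw [← hmt]; exact three_le_card_tightSet hc
  have hw : ∀ i j k, i < j → j < k → k < m →
      0 < orient3 (facetVertex X c hc0 i) (facetVertex X c hc0 j) (facetVertex X c hc0 k) :=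
    fun i j k hij hjk hk => orient3_facetVertex_pos hX1 hc hij hjk hk
  have hfan := sum_fan_angles_sub_pi_le hm3 hw
  rw [← argmaxCone_eq_polyCone hX1 h0 hc] at hfan
  rw [hmt]
  have hle : ∀ i ∈ range (m - 2), fanPenaltyLB₂ X c i ≤
      sphExcess (facetVertex X c hc0 0) (facetVertex X c hc0 (i + 1))
        (facetVertex X c hc0 (i + 2)) - hales_sol0 := fun i hi => by
    have := fanPenaltyLB₂_le h12 hX1 hV hc (i := i)
      (by rw [hmt]; have := mem_range.1 hi; omega)
    rwa [fVert_eq hc0, fVert_eq hc0, fVert_eq hc0] at this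
  have hsum := Finset.sum_le_sum hle
  rw [Finset.sum_sub_distrib, Finset.sum_const, Finset.card_range, nsmul_eq_mul] at hsum
  have hex : ∑ i ∈ range (m - 2), sphExcess (facetVertex X c hc0 0)
      (facetVertex X c hc0 (i + 1)) (facetVertex X c hc0 (i + 2)) ≤
      4 * π * ballFraction (0 : (EuclideanSpace ℝ (Fin 3))) (argmaxCone (facetNormals X) c) := by
    simpa only [sphExcess] using hfan
  have hcast : ((m - 2 : ℕ) : ℝ) = (m : ℝ) - 2 := by
    rw [Nat.cast_sub (by omega)]; norm_num
  rw [hcast] at hsum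
  linarith

/-- **The refined budget inequality**: `Σ_c Σ_i fanPenaltyLB₂ ≤ 4π − 20 sol₀`.
[cite: Hales2012, Lemma 5 and Theorem 3 (proof, weights)] -/
theorem sum_sum_fanPenaltyLB₂_le (h12 : X.card = 12) (hX1 : ∀ y ∈ X, ‖y‖ = 1)
    (hV : ∀ y ∈ X, ∀ y' ∈ X, y ≠ y' → ⟪y, y'⟫ = 1 / 2 ∨ ⟪y, y'⟫ ≤ 7 / 32) :
    ∑ c ∈ facetNormals X, ∑ i ∈ range ((tightSet X c).card - 2), fanPenaltyLB₂ X c i ≤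
      4 * π - 20 * hales_sol0 := by
  have hp : ∀ y ∈ X, ∀ y' ∈ X, y ≠ y' → ⟪y, y'⟫ ≤ 1 / 2 := fun y hy y' hy' h =>
    (hV y hy y' hy' h).elim le_of_eq fun h' => by linarith
  have h0 := zero_mem_interior_convexHull_of_twelve_unit h12 hX1 hp
  rw [← sum_facet_weight_eq h12 hX1 h0]
  exact Finset.sum_le_sum fun c hc => sum_fanPenaltyLB₂_le_facet_weight h12 hX1 hV h0 hc

end Facets


/-! ## K25: unit price 0.1 -/

/-- **`0.1 · units ≤ trianglePenaltyLB₂`** casewise (`0 ≤ 0`; `0.1 ≤ 0.1` and `0 ≤ 0` for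
two contacts; at `κ = 7/32`: `0.2 ≤ 0.26`, `0.3 ≤ 0.34` and `0.4 ≤ 0.49` for one contact and `0, 1, 2` very
long sides; `0.1 (3 + v) ≤ 0.5, 0.63` for none). [cite: Hales2012, Theorem 2 (the constants
d₃)] -/
theorem mul_triangleUnits_le_trianglePenaltyLB₂ (x y z : ℝ) :
    0.1 * triangleUnits x y z ≤ trianglePenaltyLB₂ x y z := by
  unfold triangleUnits triangleSupply triangleDeficit trianglePenaltyLB₂ trianglePenaltyLB
    veryLongCount
  by_cases hx : x = 1 / 2 <;> by_cases hy : y = 1 / 2 <;> by_cases hz : z = 1 / 2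
  · have hcc : contactCount x y z = 3 := by rw [contactCount, if_pos hx, if_pos hy, if_pos hz]
    rw [hcc]; norm_num
  · have hcc : contactCount x y z = 2 := by rw [contactCount, if_pos hx, if_pos hy, if_neg hz]
    rw [hcc]; norm_num; split_ifs <;> norm_num
  · have hcc : contactCount x y z = 2 := by rw [contactCount, if_pos hx, if_neg hy, if_pos hz]
    rw [hcc]; norm_num; split_ifs <;> norm_num
  · have hcc : contactCount x y z = 1 := by rw [contactCount, if_pos hx, if_neg hy, if_neg hz]
    rw [hcc]; norm_num
    have hx0 : ¬x < 0 := by rw [hx]; norm_num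
    split_ifs <;> norm_num
    all_goals simp_all
  · have hcc : contactCount x y z = 2 := by rw [contactCount, if_neg hx, if_pos hy, if_pos hz]
    rw [hcc]; norm_num; split_ifs <;> norm_num
  · have hcc : contactCount x y z = 1 := by rw [contactCount, if_neg hx, if_pos hy, if_neg hz]
    rw [hcc]; norm_num
    have hy0 : ¬y < 0 := by rw [hy]; norm_num
    split_ifs <;> norm_num
    all_goals simp_all
  · have hcc : contactCount x y z = 1 := by rw [contactCount, if_neg hx, if_neg hy, if_pos hz]
    rw [hcc]; norm_num
    have hz0 : ¬z < 0 := by rw [hz]; norm_num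
    split_ifs <;> norm_num
    all_goals simp_all
  · have hcc : contactCount x y z = 0 := by rw [contactCount, if_neg hx, if_neg hy, if_neg hz]
    rw [hcc]; norm_num; split_ifs <;> norm_num
    all_goals simp_all

section PerFacet


variable {X : Finset (EuclideanSpace ℝ (Fin 3))}

/-- `0.1 · fanUnits ≤ fanPenaltyLB₂`. [cite: Hales2012, Theorem 2] -/
theorem mul_fanUnits_le_fanPenaltyLB₂ (X : Finset (EuclideanSpace ℝ (Fin 3))) (c : (EuclideanSpace ℝ (Fin 3))) (i : ℕ) :
    0.1 * fanUnits X c i ≤ fanPenaltyLB₂ X c i :=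
  mul_triangleUnits_le_trianglePenaltyLB₂ _ _ _

end PerFacet


/-! ## K25 census: at least 23 contacts at κ = 7/32 (16 × 0.1 = 1.6 > 1.56 > 4π − 20 sol₀) -/

section Census


variable {X : Finset (EuclideanSpace ℝ (Fin 3))}

/-- **`sol₀ > 0.5504`** (two half-angle steps: `cos (x/4) ≥ 1 − x²/32 ≥ 0.99053`, so
`cos (x/2) = 2cos²(x/4) − 1 ≥ 0.9623` and `cos x = 2cos²(x/2) − 1 ≥ 0.85204 > 23/27 = 0.85185…`,
`x = 0.5504`). [folklore] -/
theorem lt_hales_sol0_5504 : 0.5504 < hales_sol0 := by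
  rw [hales_sol0_eq_arccos]
  have h1 : 1 - (0.5504 / 4) ^ 2 / 2 ≤ cos ((0.5504 : ℝ) / 4) := one_sub_sq_div_two_le_cos
  have hnn : (0 : ℝ) ≤ 1 - (0.5504 / 4) ^ 2 / 2 := by norm_num
  have h2 : (1 - (0.5504 / 4) ^ 2 / 2) ^ 2 ≤ cos ((0.5504 : ℝ) / 4) ^ 2 := pow_le_pow_left₀ hnn h1 2
  have h3 : cos ((0.5504 : ℝ) / 2) = 2 * cos ((0.5504 : ℝ) / 4) ^ 2 - 1 := by
    rw [cos_sq]; ring_nf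
  have h4 : (0.9623 : ℝ) ≤ cos ((0.5504 : ℝ) / 2) := by rw [h3]; nlinarith
  have h5 : (0.9623 : ℝ) ^ 2 ≤ cos ((0.5504 : ℝ) / 2) ^ 2 := pow_le_pow_left₀ (by norm_num) h4 2
  have h6 : cos (0.5504 : ℝ) = 2 * cos ((0.5504 : ℝ) / 2) ^ 2 - 1 := by
    rw [cos_sq]; ring_nf
  have hcos : (23 : ℝ) / 27 < cos 0.5504 := by rw [h6]; nlinarith
  have harc : arccos (cos (0.5504 : ℝ)) = 0.5504 :=
    arccos_cos (by norm_num) (by linarith [pi_gt_three])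
  rw [← harc]
  exact arccos_lt_arccos (by norm_num) hcos (cos_le_one _)

end Census
end Summit.Ventures.Crystal3D.Kissing125
end
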